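import Literature.NumberTheory.PAdicHodge.BmaxPlusFormalLogPeriodMap
import Literature.NumberTheory.PAdicHodge.AinfWeierstrassKummerIntegral
import Literature.RingTheory.FormalGroups.PadicLogTypeSeriesNsmul
import Mathlib.NumberTheory.Padics.RingHoms
import HarnessLib

/-!
# The `A_max`-period map on the Tate module `T_pŴ(𝒪_{ℂ_F}) → A_max`: additivity, `ℤ_p`-linearity and `Γ_F`-equivariance

Topic `Literature/NumberTheory/PAdicHodge`; namespace `Literature.NumberTheory.PAdicHodge.AinfTop`. THEOREMS ONLY (no definition, no named
fact, no instance, no `sorry`). For an integral Weierstrass equation `W/ℤ`, numerators `b` (e.g. `formalLogNum W p`), an index `N ≥ 1`, and a point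
`τ ∈ T_pŴ(𝒪_{ℂ_F})` (`TatePt F p W`) with Fontaine's integral `[τ̃] = torsionLiftHom W hθ τ ∈ Ŵ(𝔫)` (`θ[τ̃] = 0`, so `ι[τ̃] ∈ ker θ ⊂ p·B⁰_max`), the
`A_max`-period is `L_τ := Λ_N(ι[τ̃], z)` for any witness `ι[τ̃]^N = p·z` (`PadicLogSeries.logSum`; the witness does not matter, `logSum_congr_witness`).

* §1 witnesses exist for every point of `Ŵ(𝔫)` in the kernel of `θ` (`exists_witness_of_thetaPt_eq_zero`); `A_max` is `p`-adically separated
  (`eq_zero_of_forall_exists_pow_mul`);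
* §2 ★ `logSum_val_add` — **ADDITIVITY on points of `Ŵ(𝔫)`**: `Λ_N(ι(P + Q)) = Λ_N(ι P) + Λ_N(ι Q)` for `(p, ξ)`-nilpotent `P, Q` (index `N`); hence on
  `ker θ`-points and on `T_pŴ` (`logSum_torsionLiftHom_add`), `logSum_val_zero`, `logSum_torsionLiftHom_nsmul` (`ℕ`-linearity);
* §3 ★★ `logSum_torsionLiftHom_smul` — **`ℤ_p`-LINEARITY `L_{c·τ} = ι(c)·L_τ`** (`c = r + pⁿd` with `r ∈ ℕ`, Mathlib `PadicInt.appr`, so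
  `L_{c·τ} − ι(c)L_τ ∈ pⁿA_max` for every `n`);
* §4 ★ `galBmaxPlus_logSum_torsionLiftHom` — **`Γ_F`-EQUIVARIANCE `σ(L_τ) = L_{σ·τ}`**; `thetaBmaxPlus_logSum_torsionLiftHom` (`θ(L_τ) = 0`);
* §5 ★★ `exists_addMonoidHom_logSum_torsionLiftHom` — the period map as an HONEST additive map `Lh : T_pŴ →+ A_max` with `Lh τ = Λ_N(ι[τ̃], z)` for every
  witness, `ℤ_p`-linear, `Γ_F`-equivariant, `ker θ`-valued.

Composed with `φ` and with the comparison `bmaxPlusToBdR` (`BmaxPlusToBdR`, `BmaxPlusToBdRPeriods`) this gives the honest period maps `Pω = p^N·∫ω`,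
`Pη := bmaxPlusToBdR ∘ φ ∘ Lh` of B8b of the φ-road of line `kato_lever` (crux K★ `stmt-BirchSwinnertonDyer-22226`, memo
`Summits/…/Cruxes/StarredOptimalManinUnitFiveSeven/Lines/kato-lever-K2-tower-instantiation.md` §3). Infrastructure only; BSD / K★ are not proved by any
of this.

## References
* P. Colmez, *Périodes p-adiques des variétés abéliennes*, Math. Ann. 292 (1992), §2. [Colmez1992PeriodesAbeliennes]
* J.-M. Fontaine, *Le corps des périodes p-adiques*, Astérisque 223 (1994), Exp. II §1.2.2, §1.5. [FontaineAsterisque223III]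
* J. H. Silverman, *The Arithmetic of Elliptic Curves* (2009), IV.5.2. [SilvermanAEC2009]
-/

noncomputable section

open Ideal WittVector MvPowerSeries ValuativeRel Field Finset

namespace Literature.NumberTheory.PAdicHodge

namespace AinfTop

open Literature.NumberTheory.GaloisRepresentations Literature.NumberTheory.GaloisRepresentations.IsNonarchimedeanLocalField
open Literature.NumberTheory.GaloisRepresentations.LubinTate Literature.NumberTheory.EllipticCurves
open Literature.RingTheory.FormalGroups Literature.AlgebraicGeometry.Resolution
open MvPowerSeries (truncTotal)

variable {F : Type} [Field F] [ValuativeRel F] [TopologicalSpace F] [IsNonarchimedeanLocalField F]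
  [CharZero F] {p : ℕ} [Fact p.Prime] [Fact (¬ IsUnit (p : integerC F))]
  [IsAdicComplete (Ideal.span {(p : integerC F)}) (integerC F)]
  {hθ : Function.Surjective (fontaineTheta (integerC F) p)} (W : WeierstrassCurve ℤ)

/-! ## §1 Witnesses for `ker θ`-points; `A_max` is `p`-adically separated -/

/-- **A point `P ∈ Ŵ(𝔫)` with `θ(P) = 0` is `(p, ξ)`-nilpotent of every index `N ≥ 1`** (`P ∈ ker θ = ξ𝔸_inf ⊂ (p, ξ)`).
[cite: FontaineAsterisque223III, Exp. II §1.2.2] -/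
theorem coe_val_pow_mem_of_thetaPt_eq_zero (P : W.Pt (nilTheta F p hθ)) (hP : thetaPt W hθ P = 0) {N : ℕ} (hN : 1 ≤ N) :
    ((P.val : (nilTheta F p hθ).toIdeal) : AinfTop F p) ^ N ∈ (WithIdeal.i : Ideal (AinfTop F p)) := by
  have h1 : (of F p).symm ((P.val : (nilTheta F p hθ).toIdeal) : AinfTop F p) ∈ Ideal.span {(p : Ainf (p := p) F), xi} :=
    Ideal.span_mono (by simp) (mem_span_xi_of_thetaPt_eq_zero W P hP)
  have h2 : ((P.val : (nilTheta F p hθ).toIdeal) : AinfTop F p) ∈ (WithIdeal.i : Ideal (AinfTop F p)) := h1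
  obtain ⟨k, rfl⟩ := Nat.exists_eq_add_of_le hN
  rw [pow_add, pow_one]
  exact Ideal.mul_mem_right _ _ h2

/-- **Witnesses exist**: for `P ∈ Ŵ(𝔫)` with `θ(P) = 0` and `N ≥ 1`, `ι(P)^N = p·z` for some `z ∈ B⁰_max`. [cite: FontaineAsterisque223III, Exp. II §1.2.2] -/
theorem exists_witness_of_thetaPt_eq_zero (P : W.Pt (nilTheta F p hθ)) (hP : thetaPt W hθ P = 0) {N : ℕ} (hN : 1 ≤ N) :
    ∃ z : bmaxZero F p, algebraMap (Ainf (p := p) F) (bmaxZero F p)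
      ((of F p).symm ((P.val : (nilTheta F p hθ).toIdeal) : AinfTop F p)) ^ N = (p : bmaxZero F p) * z :=
  exists_algebraMap_pow_eq_natCast_mul (coe_val_pow_mem_of_thetaPt_eq_zero W P hP hN)

omit [CharZero F] [IsAdicComplete (Ideal.span {(p : integerC F)}) (integerC F)] in
set_option maxHeartbeats 1600000 in
set_option synthInstance.maxHeartbeats 400000 in
/-- **`A_max` is `p`-adically separated**: an element divisible by every power of `p` is `0`. [cite: Colmez1992PeriodesAbeliennes, §2] -/
theorem eq_zero_of_forall_exists_pow_mul {x : BmaxPlus F p} (h : ∀ n : ℕ, ∃ y : BmaxPlus F p, x = (p : BmaxPlus F p) ^ n * y) : x = 0 := by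
  refine AdicCompletion.ext_evalₐ fun n => ?_
  obtain ⟨y, hy⟩ := h n
  have hpn : AdicCompletion.evalₐ (Ideal.span {(p : bmaxZero F p)}) n ((p : BmaxPlus F p) ^ n) = 0 := by
    rw [map_pow, map_natCast, ← map_natCast (Ideal.Quotient.mk (Ideal.span {(p : bmaxZero F p)} ^ n)), ← map_pow,
      Ideal.Quotient.eq_zero_iff_mem, Ideal.span_singleton_pow]
    exact Ideal.mem_span_singleton_self _
  rw [hy, map_mul, hpn, zero_mul, map_zero]

/-! ## §2 Additivity on points of `Ŵ(𝔫)` -/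

set_option maxHeartbeats 1600000 in
/-- ★ **ADDITIVITY of the `A_max`-periods on points**: for `P, Q ∈ Ŵ(𝔫)` `(p, ξ)`-nilpotent of index `N ≥ 1` and any witnesses `z_P, z_Q, z_{P+Q}` of
`ι(P), ι(Q), ι(P + Q)`: **`Λ_N(ι(P + Q), z_{P+Q}) = Λ_N(ι P, z_P) + Λ_N(ι Q, z_Q)`** — `(P + Q).val` is the `(p, ξ)`-adic value of `F_W`
(`algebraMap_addW_sub_aeval_mem_pow`) and `log_W(F_W(X, Y)) = log_W X + log_W Y` (`PadicLogSeries.logSum_eq_add_of_forall_sub_aeval_mem'`).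
[cite: Colmez1992PeriodesAbeliennes, §2] [cite: SilvermanAEC2009, IV.5.2] -/
theorem logSum_val_add (P Q : W.Pt (nilTheta F p hθ)) {N : ℕ} (hN : 1 ≤ N)
    (hP : ((P.val : (nilTheta F p hθ).toIdeal) : AinfTop F p) ^ N ∈ (WithIdeal.i : Ideal (AinfTop F p)))
    (hQ : ((Q.val : (nilTheta F p hθ).toIdeal) : AinfTop F p) ^ N ∈ (WithIdeal.i : Ideal (AinfTop F p)))
    {zP zQ zPQ : bmaxZero F p}
    (hzP : algebraMap (Ainf (p := p) F) (bmaxZero F p) ((of F p).symm ((P.val : (nilTheta F p hθ).toIdeal) : AinfTop F p)) ^ N =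
      (p : bmaxZero F p) * zP)
    (hzQ : algebraMap (Ainf (p := p) F) (bmaxZero F p) ((of F p).symm ((Q.val : (nilTheta F p hθ).toIdeal) : AinfTop F p)) ^ N =
      (p : bmaxZero F p) * zQ)
    (hzPQ : algebraMap (Ainf (p := p) F) (bmaxZero F p) ((of F p).symm (((P + Q).val : (nilTheta F p hθ).toIdeal) : AinfTop F p)) ^ N =
      (p : bmaxZero F p) * zPQ) :
    PadicLogSeries.logSum ((algebraMap (Ainf (p := p) F) (bmaxZero F p)).comp zpToAinf) (GaloisContinuity.formalLogNum W p) N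
        (algebraMap (Ainf (p := p) F) (bmaxZero F p) ((of F p).symm (((P + Q).val : (nilTheta F p hθ).toIdeal) : AinfTop F p))) zPQ =
      PadicLogSeries.logSum ((algebraMap (Ainf (p := p) F) (bmaxZero F p)).comp zpToAinf) (GaloisContinuity.formalLogNum W p) N
          (algebraMap (Ainf (p := p) F) (bmaxZero F p) ((of F p).symm ((P.val : (nilTheta F p hθ).toIdeal) : AinfTop F p))) zP +
        PadicLogSeries.logSum ((algebraMap (Ainf (p := p) F) (bmaxZero F p)).comp zpToAinf) (GaloisContinuity.formalLogNum W p) N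
          (algebraMap (Ainf (p := p) F) (bmaxZero F p) ((of F p).symm ((Q.val : (nilTheta F p hθ).toIdeal) : AinfTop F p))) zQ := by
  haveI := isDomain_bmaxZero (F := F) (p := p)
  haveI := charZero_bmaxZero (F := F) (p := p)
  rw [val_add_N] at hzPQ ⊢
  have hyz : ∀ i : Fin 2,
      (![algebraMap (Ainf (p := p) F) (bmaxZero F p) ((of F p).symm ((P.val : (nilTheta F p hθ).toIdeal) : AinfTop F p)),
          algebraMap (Ainf (p := p) F) (bmaxZero F p) ((of F p).symm ((Q.val : (nilTheta F p hθ).toIdeal) : AinfTop F p))] :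
            Fin 2 → bmaxZero F p) i ^ N =
        (p : bmaxZero F p) * (![zP, zQ] : Fin 2 → bmaxZero F p) i := by
    intro i; fin_cases i
    · exact hzP
    · exact hzQ
  have h := PadicLogSeries.logSum_eq_add_of_forall_sub_aeval_mem' ((algebraMap (Ainf (p := p) F) (bmaxZero F p)).comp zpToAinf)
    (GaloisContinuity.formalLogNum W p) (W.map (Int.castRingHom ℚ)).formalLog
    (algebraMap_formalLogNum_eq W ((algebraMap (Ainf (p := p) F) (bmaxZero F p)).comp zpToAinf))
    W.constantCoeff_formalGroupLaw (GaloisContinuity.formalLog_subst_map_formalGroupLaw W) hN hyz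
    (fun k => ⟨(N + N) * k, fun D hD => algebraMap_addW_sub_aeval_mem_pow W _ _ hP hQ hD⟩) hzPQ
  simpa only [Matrix.cons_val_zero, Matrix.cons_val_one] using h

/-- **The period of the origin vanishes**: `Λ_N(ι 0, z) = 0` for every witness (which is forced to be `0`). [cite: Colmez1992PeriodesAbeliennes, §2] -/
theorem logSum_val_zero {N : ℕ} (hN : 1 ≤ N) {z : bmaxZero F p}
    (hz : algebraMap (Ainf (p := p) F) (bmaxZero F p) ((of F p).symm (((0 : W.Pt (nilTheta F p hθ)).val : (nilTheta F p hθ).toIdeal) :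
      AinfTop F p)) ^ N = (p : bmaxZero F p) * z) :
    PadicLogSeries.logSum ((algebraMap (Ainf (p := p) F) (bmaxZero F p)).comp zpToAinf) (GaloisContinuity.formalLogNum W p) N
        (algebraMap (Ainf (p := p) F) (bmaxZero F p) ((of F p).symm (((0 : W.Pt (nilTheta F p hθ)).val : (nilTheta F p hθ).toIdeal) :
          AinfTop F p))) z = 0 := by
  haveI := isDomain_bmaxZero (F := F) (p := p)
  haveI := charZero_bmaxZero (F := F) (p := p)
  have h0 : algebraMap (Ainf (p := p) F) (bmaxZero F p) ((of F p).symm (((0 : W.Pt (nilTheta F p hθ)).val : (nilTheta F p hθ).toIdeal) :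
      AinfTop F p)) = 0 := by
    rw [WeierstrassCurve.Pt.val_zero, ZeroMemClass.coe_zero, map_zero, map_zero]
  rw [h0] at hz ⊢
  have hz0 : z = 0 := by
    rw [zero_pow (by omega)] at hz
    exact (mul_eq_zero.1 hz.symm).resolve_left (Nat.cast_ne_zero.2 (Fact.out : p.Prime).ne_zero)
  rw [hz0]
  exact PadicLogSeries.logSum_zero_zero _ _ hN

/-- **Additivity on `T_pŴ`**: `L_{τ+τ′} = L_τ + L_{τ′}` for any witnesses (`[τ + τ′~] = [τ̃] + [τ̃′]`, `torsionLiftHom` is additive).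
[cite: Colmez1992PeriodesAbeliennes, §2] [cite: FontaineAsterisque223III, Exp. II §1.2.2] -/
theorem logSum_torsionLiftHom_add (τ τ' : TatePt F p W) {N : ℕ} (hN : 1 ≤ N) {z z' z'' : bmaxZero F p}
    (hz : algebraMap (Ainf (p := p) F) (bmaxZero F p)
        ((of F p).symm (((torsionLiftHom W hθ τ).val : (nilTheta F p hθ).toIdeal) : AinfTop F p)) ^ N = (p : bmaxZero F p) * z)
    (hz' : algebraMap (Ainf (p := p) F) (bmaxZero F p)
        ((of F p).symm (((torsionLiftHom W hθ τ').val : (nilTheta F p hθ).toIdeal) : AinfTop F p)) ^ N = (p : bmaxZero F p) * z')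
    (hz'' : algebraMap (Ainf (p := p) F) (bmaxZero F p)
        ((of F p).symm (((torsionLiftHom W hθ (τ + τ')).val : (nilTheta F p hθ).toIdeal) : AinfTop F p)) ^ N = (p : bmaxZero F p) * z'') :
    PadicLogSeries.logSum ((algebraMap (Ainf (p := p) F) (bmaxZero F p)).comp zpToAinf) (GaloisContinuity.formalLogNum W p) N
        (algebraMap (Ainf (p := p) F) (bmaxZero F p)
          ((of F p).symm (((torsionLiftHom W hθ (τ + τ')).val : (nilTheta F p hθ).toIdeal) : AinfTop F p))) z'' =
      PadicLogSeries.logSum ((algebraMap (Ainf (p := p) F) (bmaxZero F p)).comp zpToAinf) (GaloisContinuity.formalLogNum W p) N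
          (algebraMap (Ainf (p := p) F) (bmaxZero F p)
            ((of F p).symm (((torsionLiftHom W hθ τ).val : (nilTheta F p hθ).toIdeal) : AinfTop F p))) z +
        PadicLogSeries.logSum ((algebraMap (Ainf (p := p) F) (bmaxZero F p)).comp zpToAinf) (GaloisContinuity.formalLogNum W p) N
          (algebraMap (Ainf (p := p) F) (bmaxZero F p)
            ((of F p).symm (((torsionLiftHom W hθ τ').val : (nilTheta F p hθ).toIdeal) : AinfTop F p))) z' := by
  rw [map_add] at hz'' ⊢
  exact logSum_val_add W _ _ hN (coe_val_pow_mem_of_thetaPt_eq_zero W _ (thetaPt_torsionLiftHom W τ) hN)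
    (coe_val_pow_mem_of_thetaPt_eq_zero W _ (thetaPt_torsionLiftHom W τ') hN) hz hz' hz''

set_option maxHeartbeats 3200000 in
/-- **`ℕ`-linearity on `T_pŴ`**: `L_{n·τ} = n·L_τ` for any witnesses. [cite: Colmez1992PeriodesAbeliennes, §2] -/
theorem logSum_torsionLiftHom_nsmul (τ : TatePt F p W) {N : ℕ} (hN : 1 ≤ N) {z : bmaxZero F p}
    (hz : algebraMap (Ainf (p := p) F) (bmaxZero F p)
        ((of F p).symm (((torsionLiftHom W hθ τ).val : (nilTheta F p hθ).toIdeal) : AinfTop F p)) ^ N = (p : bmaxZero F p) * z)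
    (n : ℕ) {zn : bmaxZero F p}
    (hzn : algebraMap (Ainf (p := p) F) (bmaxZero F p)
        ((of F p).symm (((torsionLiftHom W hθ (n • τ)).val : (nilTheta F p hθ).toIdeal) : AinfTop F p)) ^ N = (p : bmaxZero F p) * zn) :
    PadicLogSeries.logSum ((algebraMap (Ainf (p := p) F) (bmaxZero F p)).comp zpToAinf) (GaloisContinuity.formalLogNum W p) N
        (algebraMap (Ainf (p := p) F) (bmaxZero F p)
          ((of F p).symm (((torsionLiftHom W hθ (n • τ)).val : (nilTheta F p hθ).toIdeal) : AinfTop F p))) zn =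
      (n : BmaxPlus F p) *
        PadicLogSeries.logSum ((algebraMap (Ainf (p := p) F) (bmaxZero F p)).comp zpToAinf) (GaloisContinuity.formalLogNum W p) N
          (algebraMap (Ainf (p := p) F) (bmaxZero F p)
            ((of F p).symm (((torsionLiftHom W hθ τ).val : (nilTheta F p hθ).toIdeal) : AinfTop F p))) z := by
  haveI := isDomain_bmaxZero (F := F) (p := p)
  haveI := charZero_bmaxZero (F := F) (p := p)
  induction n generalizing zn with
  | zero =>
    rw [zero_nsmul, map_zero] at hzn
    rw [Nat.cast_zero, zero_mul, zero_nsmul, map_zero]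
    exact logSum_val_zero W hN hzn
  | succ n ih =>
    obtain ⟨zn', hzn'⟩ := exists_witness_of_thetaPt_eq_zero W _ (thetaPt_torsionLiftHom W (n • τ)) hN
    have e : (n + 1) • τ = n • τ + τ := succ_nsmul τ n
    rw [e] at hzn ⊢
    have hadd := logSum_torsionLiftHom_add W (n • τ) τ hN hzn' hz hzn
    rw [hadd, ih hzn', Nat.cast_succ]
    ring

/-! ## §3 `ℤ_p`-linearity -/

set_option maxHeartbeats 3200000 in
/-- ★★ **`ℤ_p`-LINEARITY `L_{c·τ} = ι(c)·L_τ`** (`c ∈ ℤ_p`, `ι(c) = ι(zpToAinf c) ∈ A_max`; any witnesses). Writing `c = r + pⁿ·d` with `r ∈ ℕ`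
(`PadicInt.appr`), additivity and `ℕ`-linearity give `L_{c·τ} − ι(c)·L_τ = pⁿ·(L_{d·τ} − ι(d)·L_τ)` for every `n`, and `A_max` is `p`-adically separated.
[cite: Colmez1992PeriodesAbeliennes, §2] [cite: FontaineAsterisque223III, Exp. II §1.5] -/
theorem logSum_torsionLiftHom_smul (c : ℤ_[p]) (τ : TatePt F p W) {N : ℕ} (hN : 1 ≤ N) {z zc : bmaxZero F p}
    (hz : algebraMap (Ainf (p := p) F) (bmaxZero F p)
        ((of F p).symm (((torsionLiftHom W hθ τ).val : (nilTheta F p hθ).toIdeal) : AinfTop F p)) ^ N = (p : bmaxZero F p) * z)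
    (hzc : algebraMap (Ainf (p := p) F) (bmaxZero F p)
        ((of F p).symm (((torsionLiftHom W hθ (c • τ)).val : (nilTheta F p hθ).toIdeal) : AinfTop F p)) ^ N = (p : bmaxZero F p) * zc) :
    PadicLogSeries.logSum ((algebraMap (Ainf (p := p) F) (bmaxZero F p)).comp zpToAinf) (GaloisContinuity.formalLogNum W p) N
        (algebraMap (Ainf (p := p) F) (bmaxZero F p)
          ((of F p).symm (((torsionLiftHom W hθ (c • τ)).val : (nilTheta F p hθ).toIdeal) : AinfTop F p))) zc =
      ainfToBmaxPlus F p (zpToAinf c) *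
        PadicLogSeries.logSum ((algebraMap (Ainf (p := p) F) (bmaxZero F p)).comp zpToAinf) (GaloisContinuity.formalLogNum W p) N
          (algebraMap (Ainf (p := p) F) (bmaxZero F p)
            ((of F p).symm (((torsionLiftHom W hθ τ).val : (nilTheta F p hθ).toIdeal) : AinfTop F p))) z := by
  rw [← sub_eq_zero]
  refine eq_zero_of_forall_exists_pow_mul fun n => ?_
  -- `c = r + p^n d`
  obtain ⟨d, hd⟩ := Ideal.mem_span_singleton'.1 (PadicInt.appr_spec n c)
  obtain ⟨r, hr⟩ : ∃ r : ℕ, c.appr n = r := ⟨_, rfl⟩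
  rw [hr] at hd
  have hc : c = (r : ℤ_[p]) + (p : ℤ_[p]) ^ n * d := by rw [mul_comm, hd]; ring
  have hsmul : c • τ = r • τ + p ^ n • (d • τ) := by
    rw [hc, add_smul, Nat.cast_smul_eq_nsmul, mul_smul, ← Nat.cast_pow, Nat.cast_smul_eq_nsmul]
  -- witnesses for the intermediate points
  obtain ⟨zr, hzr⟩ := exists_witness_of_thetaPt_eq_zero W _ (thetaPt_torsionLiftHom W (r • τ)) hN
  obtain ⟨zd, hzd⟩ := exists_witness_of_thetaPt_eq_zero W _ (thetaPt_torsionLiftHom W (d • τ)) hN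
  obtain ⟨zpd, hzpd⟩ := exists_witness_of_thetaPt_eq_zero W _ (thetaPt_torsionLiftHom W (p ^ n • (d • τ))) hN
  rw [hsmul] at hzc ⊢
  -- the three periods
  set Lτ := PadicLogSeries.logSum ((algebraMap (Ainf (p := p) F) (bmaxZero F p)).comp zpToAinf) (GaloisContinuity.formalLogNum W p) N
    (algebraMap (Ainf (p := p) F) (bmaxZero F p)
      ((of F p).symm (((torsionLiftHom W hθ τ).val : (nilTheta F p hθ).toIdeal) : AinfTop F p))) z with hLτ
  set Ld := PadicLogSeries.logSum ((algebraMap (Ainf (p := p) F) (bmaxZero F p)).comp zpToAinf) (GaloisContinuity.formalLogNum W p) N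
    (algebraMap (Ainf (p := p) F) (bmaxZero F p)
      ((of F p).symm (((torsionLiftHom W hθ (d • τ)).val : (nilTheta F p hθ).toIdeal) : AinfTop F p))) zd with hLd
  have h1 := logSum_torsionLiftHom_add W (r • τ) (p ^ n • (d • τ)) hN hzr hzpd hzc
  have h2 := logSum_torsionLiftHom_nsmul W τ hN hz r hzr
  have h3 := logSum_torsionLiftHom_nsmul W (d • τ) hN hzd (p ^ n) hzpd
  have hι : ainfToBmaxPlus F p (zpToAinf c) = (r : BmaxPlus F p) + (p : BmaxPlus F p) ^ n * ainfToBmaxPlus F p (zpToAinf d) := by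
    rw [hc, map_add, map_mul, map_pow, map_natCast, map_natCast, map_add, map_mul, map_pow, map_natCast, map_natCast]
  refine ⟨Ld - ainfToBmaxPlus F p (zpToAinf d) * Lτ, ?_⟩
  rw [h1, h2, h3, hι, Nat.cast_pow]
  ring

/-! ## §4 `Γ_F`-equivariance and `θ = 0` -/

set_option maxHeartbeats 1600000 in
/-- ★ **`Γ_F`-EQUIVARIANCE `σ(L_τ) = L_{σ·τ}`** for any witnesses (`σ[τ̃] = [σ·τ~]`, `galPtN_torsionLiftHom`; naturality
`galBmaxPlus_logSum_divisionLiftPt`). [cite: FontaineAsterisque223III, Exp. II §1.2, §1.5] -/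
theorem galBmaxPlus_logSum_torsionLiftHom (σ : absoluteGaloisGroup F) (τ : TatePt F p W) (N : ℕ) {z z' : bmaxZero F p}
    (hz : algebraMap (Ainf (p := p) F) (bmaxZero F p)
        ((of F p).symm (((torsionLiftHom W hθ τ).val : (nilTheta F p hθ).toIdeal) : AinfTop F p)) ^ N = (p : bmaxZero F p) * z)
    (hz' : algebraMap (Ainf (p := p) F) (bmaxZero F p)
        ((of F p).symm (((torsionLiftHom W hθ (σ • τ)).val : (nilTheta F p hθ).toIdeal) : AinfTop F p)) ^ N = (p : bmaxZero F p) * z') :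
    galBmaxPlus σ (PadicLogSeries.logSum ((algebraMap (Ainf (p := p) F) (bmaxZero F p)).comp zpToAinf) (GaloisContinuity.formalLogNum W p) N
        (algebraMap (Ainf (p := p) F) (bmaxZero F p)
          ((of F p).symm (((torsionLiftHom W hθ τ).val : (nilTheta F p hθ).toIdeal) : AinfTop F p))) z) =
      PadicLogSeries.logSum ((algebraMap (Ainf (p := p) F) (bmaxZero F p)).comp zpToAinf) (GaloisContinuity.formalLogNum W p) N
        (algebraMap (Ainf (p := p) F) (bmaxZero F p)
          ((of F p).symm (((torsionLiftHom W hθ (σ • τ)).val : (nilTheta F p hθ).toIdeal) : AinfTop F p))) z' := by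
  haveI := isDomain_bmaxZero (F := F) (p := p)
  haveI := charZero_bmaxZero (F := F) (p := p)
  have h := galBmaxPlus_logSum_divisionLiftPt W (hθ := hθ) (GaloisContinuity.formalLogNum W p) σ (mulPC_seq W τ) N z
  -- `σ z` is a witness for `ι[σ·τ~]`
  have hσz : algebraMap (Ainf (p := p) F) (bmaxZero F p)
      ((of F p).symm (((torsionLiftHom W hθ (σ • τ)).val : (nilTheta F p hθ).toIdeal) : AinfTop F p)) ^ N =
        (p : bmaxZero F p) * galBmaxZero σ z := by
    rw [← galPtN_torsionLiftHom]
    have h2 := congrArg (galBmaxZero σ) hz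
    rw [map_pow, map_mul, map_natCast] at h2
    rw [← h2, coe_val_galPtN, gal_of_symm]
  exact h.trans (PadicLogSeries.logSum_congr_witness _ _ hσz hz')
where
  /-- `(of F p).symm (gal F p σ a) = galAinf σ ((of F p).symm a)` read through `𝔸_inf → B⁰_max`. [folklore] -/
  gal_of_symm {σ : absoluteGaloisGroup F} {a : AinfTop F p} :
      algebraMap (Ainf (p := p) F) (bmaxZero F p) ((of F p).symm (gal F p σ a)) =
        galBmaxZero σ (algebraMap (Ainf (p := p) F) (bmaxZero F p) ((of F p).symm a)) :=
    (Subtype.ext (galAinfLoc_algebraMap σ ((of F p).symm a))).symm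

/-- **`θ(L_τ) = 0`**: the periods of `T_pŴ` lie in `ker θ`. [cite: Colmez1992PeriodesAbeliennes, §2] -/
theorem thetaBmaxPlus_logSum_torsionLiftHom (τ : TatePt F p W) {N : ℕ} (hN : 1 ≤ N) {z : bmaxZero F p}
    (hz : algebraMap (Ainf (p := p) F) (bmaxZero F p)
        ((of F p).symm (((torsionLiftHom W hθ τ).val : (nilTheta F p hθ).toIdeal) : AinfTop F p)) ^ N = (p : bmaxZero F p) * z) :
    thetaBmaxPlus F p (PadicLogSeries.logSum ((algebraMap (Ainf (p := p) F) (bmaxZero F p)).comp zpToAinf) (GaloisContinuity.formalLogNum W p) N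
        (algebraMap (Ainf (p := p) F) (bmaxZero F p)
          ((of F p).symm (((torsionLiftHom W hθ τ).val : (nilTheta F p hθ).toIdeal) : AinfTop F p))) z) = 0 :=
  thetaBmaxPlus_logSum_divisionLiftPt_eq_zero W (hθ := hθ) _ (mulPC_seq W τ) (by rw [seq_zero]; rfl) hN hz

/-! ## §5 The period map as an honest additive map `T_pŴ →+ A_max` -/

set_option maxHeartbeats 1600000 in
/-- ★★ **The `A_max`-period map `T_pŴ(𝒪_{ℂ_F}) →+ A_max` as an honest additive map** (`N ≥ 1`): there is `Lh : TatePt F p W →+ BmaxPlus F p` with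
`Lh τ = Λ_N(ι[τ̃], z)` for EVERY witness `z`; it is `ℤ_p`-linear (`Lh (c·τ) = ι(c)·Lh τ`), `Γ_F`-equivariant (`σ(Lh τ) = Lh(σ·τ)`) and `ker θ`-valued.
Composed with `φ` and the comparison `B_max⁺ → B_dR⁺` it yields the honest period maps `Pω = p^N·∫ω`, `Pη` of the φ-road.
[cite: Colmez1992PeriodesAbeliennes, §2] [cite: FontaineAsterisque223III, Exp. II §1.5] -/
theorem exists_addMonoidHom_logSum_torsionLiftHom {N : ℕ} (hN : 1 ≤ N) :
    ∃ Lh : TatePt F p W →+ BmaxPlus F p,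
      (∀ (τ : TatePt F p W) (z : bmaxZero F p),
        algebraMap (Ainf (p := p) F) (bmaxZero F p)
            ((of F p).symm (((torsionLiftHom W hθ τ).val : (nilTheta F p hθ).toIdeal) : AinfTop F p)) ^ N = (p : bmaxZero F p) * z →
        Lh τ = PadicLogSeries.logSum ((algebraMap (Ainf (p := p) F) (bmaxZero F p)).comp zpToAinf) (GaloisContinuity.formalLogNum W p) N
          (algebraMap (Ainf (p := p) F) (bmaxZero F p)
            ((of F p).symm (((torsionLiftHom W hθ τ).val : (nilTheta F p hθ).toIdeal) : AinfTop F p))) z) ∧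
      (∀ (c : ℤ_[p]) (τ : TatePt F p W), Lh (c • τ) = ainfToBmaxPlus F p (zpToAinf c) * Lh τ) ∧
      (∀ (σ : absoluteGaloisGroup F) (τ : TatePt F p W), galBmaxPlus σ (Lh τ) = Lh (σ • τ)) ∧
      (∀ τ : TatePt F p W, thetaBmaxPlus F p (Lh τ) = 0) := by
  haveI := isDomain_bmaxZero (F := F) (p := p)
  haveI := charZero_bmaxZero (F := F) (p := p)
  choose zf hzf using fun τ : TatePt F p W => exists_witness_of_thetaPt_eq_zero W _ (thetaPt_torsionLiftHom W (hθ := hθ) τ) hN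
  refine ⟨AddMonoidHom.mk' (fun τ => PadicLogSeries.logSum ((algebraMap (Ainf (p := p) F) (bmaxZero F p)).comp zpToAinf)
      (GaloisContinuity.formalLogNum W p) N
      (algebraMap (Ainf (p := p) F) (bmaxZero F p)
        ((of F p).symm (((torsionLiftHom W hθ τ).val : (nilTheta F p hθ).toIdeal) : AinfTop F p))) (zf τ))
      (fun τ τ' => logSum_torsionLiftHom_add W τ τ' hN (hzf τ) (hzf τ') (hzf (τ + τ'))), ?_, ?_, ?_, ?_⟩
  · intro τ z hz
    exact PadicLogSeries.logSum_congr_witness _ _ (hzf τ) hz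
  · intro c τ
    exact logSum_torsionLiftHom_smul W c τ hN (hzf τ) (hzf (c • τ))
  · intro σ τ
    exact galBmaxPlus_logSum_torsionLiftHom W σ τ N (hzf τ) (hzf (σ • τ))
  · intro τ
    exact thetaBmaxPlus_logSum_torsionLiftHom W τ hN (hzf τ)

end AinfTop

end Literature.NumberTheory.PAdicHodge

end
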